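import Summits.CriticalPhenomena.PercolationContinuityZ3.Theorems.PercNearOneGluingNoHeavyLowerTailSahiCubeThreeAllOrders
import Summits.CriticalPhenomena.PercolationContinuityZ3.Theorems.PercNearOneGluingNoHeavyLowerTailSahiHereditaryMeetAbsorption
import Literature.Combinatorics.Sahi2008.PushForward
import Mathlib.Algebra.BigOperators.Group.Finset.Piecewise
import Mathlib.Tactic.FinCases
import Mathlib.Tactic.Linarith
import Mathlib.Tactic.Ring
import HarnessLib

/-!
# `NoHeavyLowerTail` (crux stmt-CriticalPhenomena-4575), master-family line P2 (Sahi's algebraic route): the SUNFLOWER POSET `M_m` for every `m` —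
# up-sets, the co-singleton lemma, and the STRUCTURE THEOREM of the Sahi hierarchy (all orders ⟺ pairs ∧ the co-singleton families)

Support file (seat `prim-masterthm-p2`, gen 3; `--supports stmt-CriticalPhenomena-4575`); no named fact, no sorry.  Memo SAHI-ROUTE.md §4.10–4.12.
Generalises to every `m` the infrastructure of `…SahiSunflowerAllOrders` (`M3`), `…SahiSunflowerFourPoint/Hierarchy/AllOrders` (`M4`).

SETTING.  `m` events `S_1, …, S_m` forming a SUNFLOWER (pairwise intersections = the common core `K`; petals `C_j = S_j ∖ K` pairwise disjoint;
outside `O`) generate the cell poset `Sun m = {core < pet 0, …, pet (m−1) < out}`; Sahi's `E_n` of monotone pattern-measurable functions under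
any law are the `E_n` on `Sun m` under the pushed weight `ν = (a; c_0..c_{m−1}; b)`.  Percolation: `S_x = {A ∖ {x} lies in one open cluster}`
(`x ∈ A`, `|A| = m`) — the `m`-point "all-but-one-joined" algebra, whose top row is `mPT-LB` (`m = 3`: `3PT-LB`, theorem; `m = 4`: `FourPointLBRow`).

CONTENT (all kernel-checked, every `m`, every probability weight `ν`):
* `Sun m` with its order, `Fintype`, `PartialOrder`; the up-sets are `∅`, `univ` and `U S = {out} ∪ {pet j : j ∈ S}` (`upset_cases`), `U S ⊆ U T ↔ S ⊆ T`;
  `ex ν χ_{U S} = b + Σ_{j∈S} c_j`.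
* `exists_eq_U_of_antichain`: an antichain of `≥ 2` up-sets is a `U`-family; **`exists_absorber_or_coSingleton` (the CO-SINGLETON LEMMA)**: a family of
  index sets `(S_i)` either has a member containing the intersection of the others (`S_p ⊇ ⋂_{j≠p} S_j` — then `χ_{U(S_p)}` ABSORBS the product of the
  others, `absorbs_of_absI`), or there are DISTINCT points `x_i` with `x_i ∉ S_i`, `x_i ∈ S_j (j ≠ i)` (co-singleton form `S_i = (X∖x_i) ⊔ T_i`; then
  `k ≤ m`).
* **STRUCTURE THEOREM `sahiPositive_iff_two_and_coSingleton`**: `(∀ n, SahiPositive ν n) ↔ SahiPositive ν 2 ∧ [E_k ≥ 0 for every co-singleton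
  `U`-family, `3 ≤ k ≤ m]` — by the antichain basis, the nested-pair peel (`SahiCubeAllOrders.sahiE_setInd_nonneg_of_nested`) and prim-l12-p5's Theorem G
  (`SahiHereditaryMeetAbsorption.sahiE_nonneg_of_sahiPositive_of_absorbing`) for absorbing families; orders `> m` need nothing.
* `sahiPositive_two_of_petalPairs`: if `c_A · c_B ≤ a · b` for all disjoint petal sets `A, B` (e.g. `ab ≥ e₂(c)`, which the top row implies), then
  `SahiPositive ν 2` — the pair layer is a consequence of the row (THEOREM A of the memo, §4.12(c)).
The numerical/certified picture (memo §4.12(d–f)): for `m ≤ 6` every co-singleton `E_k` is dominated by the top row (`∏(i+a)·E_k(F) − E_m(D) ≥ 0`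
coefficientwise, exact certificates), so the whole hierarchy on `Sun m` is the single row (`m = 4` in Lean: `M4.sahiPositive_iff_two_and_row`).
-/

namespace Summit.CriticalPhenomena.PercolationContinuityZ3.Theorems.SahiDeltaSystem

open Finset Function Literature.Combinatorics.Sahi2008

/-- The sunflower poset with `m` petals: a bottom `core`, `m` pairwise incomparable petals, a top `out`. [this work] -/
inductive Sun (m : ℕ) : Type
  | core : Sun m
  | pet : Fin m → Sun m
  | out : Sun m
  deriving DecidableEq

namespace Sun

variable {m : ℕ}

/-- The order of `Sun m` as a Boolean table. [this work] -/
def leb : Sun m → Sun m → Bool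
  | core, _ => true
  | pet i, pet j => decide (i = j)
  | pet _, out => true
  | out, out => true
  | _, _ => false

/-- The order of `Sun m`. [this work] -/
instance : LE (Sun m) := ⟨fun x y => leb x y = true⟩

/-- The order of `Sun m` is decidable. [this work] -/
instance decLE : DecidableRel (α := Sun m) (· ≤ ·) := fun x y => inferInstanceAs (Decidable (leb x y = true))

/-- The order of `Sun m`, explicitly: `x ≤ y` iff `x = core` or `y = out` or `x = y`. [this work] -/
theorem le_iff (x y : Sun m) : x ≤ y ↔ x = core ∨ y = out ∨ x = y := by
  show leb x y = true ↔ _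
  cases x <;> cases y <;> simp [leb]

/-- `pet` is injective. [this work] -/
theorem pet_injective : Function.Injective (pet : Fin m → Sun m) := fun i j h => by cases h; rfl

/-- The `m + 2` points of `Sun m`. [this work] -/
instance : Fintype (Sun m) where
  elems := insert core (insert out (Finset.univ.map ⟨pet, pet_injective⟩))
  complete := by intro x; cases x <;> simp

/-- `Sun m` is a partial order. [this work] -/
instance : PartialOrder (Sun m) where
  le := (· ≤ ·)
  le_refl x := (le_iff x x).2 (Or.inr (Or.inr rfl))
  le_trans x y z hxy hyz := by
    rw [le_iff] at hxy hyz ⊢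
    rcases hxy with rfl | rfl | rfl
    · exact Or.inl rfl
    · rcases hyz with h | rfl | rfl
      · exact absurd h (by simp)
      · exact Or.inr (Or.inl rfl)
      · exact Or.inr (Or.inl rfl)
    · exact hyz
  le_antisymm x y hxy hyx := by
    rw [le_iff] at hxy hyx
    rcases hxy with rfl | rfl | rfl
    · rcases hyx with h | h | h
      · exact h.symm
      · exact absurd h (by simp)
      · exact h.symm
    · rcases hyx with h | h | h
      · exact absurd h (by simp)
      · exact h
      · exact h.symm
    · rfl

/-- The sum over `Sun m` written out. [this work] -/
theorem sum_eq (f : Sun m → ℝ) : ∑ x, f x = f core + f out + ∑ j, f (pet j) := by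
  show Finset.sum (insert core (insert out (Finset.univ.map ⟨pet, pet_injective⟩))) f = _
  rw [Finset.sum_insert (by simp), Finset.sum_insert (by simp), Finset.sum_map]
  simp only [Function.Embedding.coeFn_mk]
  ring

/-! ## Up-sets -/

/-- `U S = {out} ∪ {pet j : j ∈ S}`. [this work] -/
def U (S : Finset (Fin m)) : Finset (Sun m) := insert out (S.map ⟨pet, pet_injective⟩)

/-- `pet j ∈ U S ↔ j ∈ S`. [this work] -/
@[simp] theorem pet_mem_U (S : Finset (Fin m)) (j : Fin m) : pet j ∈ U S ↔ j ∈ S := by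
  simp [U]

/-- `core ∉ U S`. [this work] -/
@[simp] theorem core_not_mem_U (S : Finset (Fin m)) : core ∉ U S := by simp [U]

/-- `out ∈ U S`. [this work] -/
@[simp] theorem out_mem_U (S : Finset (Fin m)) : out ∈ U S := by simp [U]

/-- The `U S` are up-sets. [this work] -/
theorem isUpperSet_U (S : Finset (Fin m)) : IsUpperSet ((U S : Finset (Sun m)) : Set (Sun m)) := by
  intro x y hxy hx
  rw [Finset.mem_coe] at hx ⊢
  rcases (le_iff x y).1 hxy with rfl | rfl | rfl
  · exact absurd hx (core_not_mem_U S)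
  · exact out_mem_U S
  · exact hx

/-- Inclusion of `U`-sets is inclusion of index sets. [this work] -/
theorem U_subset_U_iff (S T : Finset (Fin m)) : U S ⊆ U T ↔ S ⊆ T := by
  constructor
  · intro h j hj
    exact (pet_mem_U T j).1 (h ((pet_mem_U S j).2 hj))
  · intro h x hx
    rcases x with _ | j | _
    · exact absurd hx (core_not_mem_U S)
    · exact (pet_mem_U T j).2 (h ((pet_mem_U S j).1 hx))
    · exact out_mem_U T

/-- `U S ∩ U T = U (S ∩ T)`. [this work] -/
theorem U_inter (S T : Finset (Fin m)) : U S ∩ U T = U (S ∩ T) := by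
  ext x
  rcases x with _ | j | _ <;> simp

/-- **The up-sets of `Sun m`** are `∅`, `univ` and the `U S`. [this work] -/
theorem upset_cases (V : Finset (Sun m)) (hV : IsUpperSet ((V : Finset (Sun m)) : Set (Sun m))) :
    V = ∅ ∨ V = Finset.univ ∨ ∃ S : Finset (Fin m), V = U S := by
  by_cases hc : core ∈ V
  · refine Or.inr (Or.inl (Finset.eq_univ_of_forall fun y => ?_))
    exact Finset.mem_coe.1 (hV ((le_iff core y).2 (Or.inl rfl)) (Finset.mem_coe.2 hc))
  · rcases Finset.eq_empty_or_nonempty V with h | ⟨x, hx⟩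
    · exact Or.inl h
    · have hout : out ∈ V := Finset.mem_coe.1 (hV ((le_iff x out).2 (Or.inr (Or.inl rfl))) (Finset.mem_coe.2 hx))
      refine Or.inr (Or.inr ⟨Finset.univ.filter (fun j => pet j ∈ V), ?_⟩)
      ext y
      rcases y with _ | j | _
      · simp only [core_not_mem_U, iff_false]; exact hc
      · simp
      · simp only [out_mem_U, iff_true]; exact hout

/-- `E χ_{U S} = b + Σ_{j ∈ S} c_j`. [this work] -/
theorem ex_setInd_U (ν : Sun m → ℝ) (S : Finset (Fin m)) : ex ν (setInd (U S)) = ν out + ∑ j ∈ S, ν (pet j) := by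
  rw [ex_def, sum_eq]
  simp [setInd_apply, Finset.sum_ite_mem, Finset.univ_inter]

/-- `E χ_V ≤ 1` under a probability weight. [this work] -/
theorem ex_setInd_le_one {ν : Sun m → ℝ} (hν0 : ∀ x, 0 ≤ ν x) (hν1 : ∑ x, ν x = 1) (V : Finset (Sun m)) :
    ex ν (setInd V) ≤ 1 :=
  calc ex ν (setInd V) ≤ ex ν (fun _ => (1 : ℝ)) :=
        ex_mono hν0 fun x => by rw [setInd_apply]; split_ifs <;> norm_num
    _ = 1 := ex_const hν1 1

/-! ## Antichains are `U`-families; the co-singleton lemma -/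

/-- In an antichain family of at least two up-sets of `Sun m`, every member is some `U S`. [this work] -/
theorem exists_eq_U_of_antichain {n : ℕ} (W : Fin (n + 2) → Finset (Sun m)) (hW : ∀ i, IsUpperSet ((W i : Finset (Sun m)) : Set (Sun m)))
    (hanti : Pairwise fun i j => ¬ W j ⊆ W i) : ∃ S : Fin (n + 2) → Finset (Fin m), ∀ i, W i = U (S i) := by
  have key : ∀ i, ∃ T : Finset (Fin m), W i = U T := by
    intro i
    obtain ⟨j, hj⟩ := exists_ne i
    rcases upset_cases (W i) (hW i) with h | h | ⟨T, hT⟩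
    · exact absurd (h ▸ Finset.empty_subset (W j)) (hanti hj)
    · exact absurd (h ▸ Finset.subset_univ (W j)) (hanti hj.symm)
    · exact ⟨T, hT⟩
  choose S hS using key
  exact ⟨S, hS⟩

/-- **The co-singleton lemma.**  A family of index sets either has a member containing the intersection of the others, or admits DISTINCT
witnesses `x_i ∉ S_i` with `x_i ∈ S_j` for all `j ≠ i` (co-singleton form `S_i ∩ X = X ∖ {x_i}`, `X = {x_i}`). [this work] -/
theorem exists_absorber_or_coSingleton {k : ℕ} (S : Fin k → Finset (Fin m)) :
    (∃ p, ∀ x, (∀ j, j ≠ p → x ∈ S j) → x ∈ S p) ∨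
      ∃ x : Fin k → Fin m, Function.Injective x ∧ (∀ i, x i ∉ S i) ∧ ∀ i j, i ≠ j → x i ∈ S j := by
  by_cases h : ∃ p, ∀ x, (∀ j, j ≠ p → x ∈ S j) → x ∈ S p
  · exact Or.inl h
  · push Not at h
    choose x hx using h
    refine Or.inr ⟨x, fun i i' hii' => ?_, fun i => (hx i).2, fun i j hij => (hx i).1 j (Ne.symm hij)⟩
    by_contra hne
    exact (hx i').2 (hii' ▸ (hx i).1 i' (Ne.symm hne))

/-- A family in co-singleton form has at most `m` members. [this work] -/
theorem le_of_coSingleton {k : ℕ} {x : Fin k → Fin m} (hx : Function.Injective x) : k ≤ m := by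
  simpa using Fintype.card_le_of_injective x hx

/-- **An index set containing the intersection of the others gives an ABSORBING slot**: `(1 − χ_{U(S p)})·∏_{i ≠ p} χ_{U(S i)} = 0` on `Sun m`.
[this work] -/
theorem absorbs_of_absI {n : ℕ} (S : Fin (n + 2) → Finset (Fin m)) (p : Fin (n + 2))
    (hp : ∀ x : Fin m, (∀ j, j ≠ p → x ∈ S j) → x ∈ S p) (a : Sun m) :
    (1 - setInd (U (S p)) a) * ∏ i ∈ Finset.univ.erase p, setInd (U (S i)) a = 0 := by
  by_cases ha : a ∈ U (S p)
  · simp [setInd_apply, ha]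
  · have key : ∃ j, j ≠ p ∧ a ∉ U (S j) := by
      rcases a with _ | x | _
      · obtain ⟨j, hj⟩ := exists_ne p
        exact ⟨j, hj, core_not_mem_U _⟩
      · by_contra h
        push Not at h
        exact ha ((pet_mem_U _ _).2 (hp x fun j hj => (pet_mem_U _ _).1 (h j hj)))
      · exact absurd (out_mem_U _) ha
    obtain ⟨j, hjp, hj⟩ := key
    rw [Finset.prod_eq_zero (Finset.mem_erase.2 ⟨hjp, Finset.mem_univ j⟩) (by simp [setInd_apply, hj]), mul_zero]

/-- **Theorem G applied on `Sun m`**: order `n + 1` of the weight and an absorbing index set give `E_{n+2} ≥ 0` for the `U`-family. [this work] -/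
theorem sahiE_setInd_U_nonneg_of_absI {ν : Sun m → ℝ} (hν0 : ∀ x, 0 ≤ ν x) (hν1 : ∑ x, ν x = 1) {n : ℕ}
    (hS : SahiPositive ν (n + 1)) (S : Fin (n + 2) → Finset (Fin m)) {p : Fin (n + 2)}
    (hp : ∀ x : Fin m, (∀ j, j ≠ p → x ∈ S j) → x ∈ S p) :
    0 ≤ sahiE ν (n + 2) (fun i => setInd (U (S i))) := by
  refine SahiHereditaryMeetAbsorption.sahiE_nonneg_of_sahiPositive_of_absorbing hν0 hν1 (Nat.succ_pos n) hS (n + 2) _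
    (fun i a => ?_) (fun i => monotone_setInd (isUpperSet_U (S i))) (fun T hT => ?_)
  · rw [setInd_apply]; split_ifs <;> simp
  · have hTu : T = Finset.univ :=
      Finset.eq_univ_of_card T (le_antisymm (Finset.card_le_univ T) (by rw [Fintype.card_fin]; omega))
    subst hTu
    exact ⟨p, Finset.mem_univ p, absorbs_of_absI S p hp⟩

/-! ## The structure theorem -/

/-- **Structure theorem, indicator form.**  If the weight is Sahi-positive of order `2` and `E_k ≥ 0` for every CO-SINGLETON `U`-family with
`k ≥ 3` members, then `E_k ≥ 0` for every family of up-sets of `Sun m`, every `k` (antichain basis + peel + Theorem G for absorbing families).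
[this work] -/
theorem sahiE_setInd_nonneg_of_two_of_coSingleton {ν : Sun m → ℝ} (hν0 : ∀ x, 0 ≤ ν x) (hν1 : ∑ x, ν x = 1) (hS2 : SahiPositive ν 2)
    (hco : ∀ (k : ℕ) (S : Fin (k + 3) → Finset (Fin m)) (x : Fin (k + 3) → Fin m), Function.Injective x →
      (∀ i, x i ∉ S i) → (∀ i j, i ≠ j → x i ∈ S j) → 0 ≤ sahiE ν (k + 3) (fun i => setInd (U (S i)))) :
    ∀ (k : ℕ) (W : Fin (k + 1) → Finset (Sun m)), (∀ i, IsUpperSet ((W i : Finset (Sun m)) : Set (Sun m))) →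
      0 ≤ sahiE ν (k + 1) (fun i => setInd (W i)) := by
  intro k
  induction k with
  | zero =>
    intro W _
    rw [sahiE_one_apply]
    exact ex_nonneg hν0 fun x => setInd_nonneg _ _
  | succ k ih =>
    intro W hW
    by_cases hanti : Pairwise fun i j => ¬ W j ⊆ W i
    · obtain ⟨S, hS⟩ := exists_eq_U_of_antichain W hW hanti
      have hWS : (fun i => setInd (W i)) = fun i => setInd (U (S i)) := by funext i; rw [hS]
      rw [hWS]
      rcases exists_absorber_or_coSingleton S with ⟨p, hp⟩ | ⟨x, hx, hxS, hxS'⟩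
      · exact sahiE_setInd_U_nonneg_of_absI hν0 hν1 ((sahiPositive_iff_indicators ν (k + 1)).2 ih) S hp
      · cases k with
        | zero => exact (sahiPositive_iff_indicators ν 2).1 hS2 (fun i => U (S i)) fun i => isUpperSet_U _
        | succ k' => exact hco k' S x hx hxS hxS'
    · unfold Pairwise at hanti
      push Not at hanti
      obtain ⟨i, j, hij, hsub⟩ := hanti
      exact SahiCubeAllOrders.sahiE_setInd_nonneg_of_nested hν0 hν1 ih W hW hij hsub

/-- **Structure theorem**: pairs and the co-singleton families carry the whole Sahi hierarchy of `Sun m`. [this work] -/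
theorem sahiPositive_of_two_of_coSingleton {ν : Sun m → ℝ} (hν0 : ∀ x, 0 ≤ ν x) (hν1 : ∑ x, ν x = 1) (hS2 : SahiPositive ν 2)
    (hco : ∀ (k : ℕ) (S : Fin (k + 3) → Finset (Fin m)) (x : Fin (k + 3) → Fin m), Function.Injective x →
      (∀ i, x i ∉ S i) → (∀ i j, i ≠ j → x i ∈ S j) → 0 ≤ sahiE ν (k + 3) (fun i => setInd (U (S i))))
    (n : ℕ) : SahiPositive ν n := by
  match n with
  | 0 => exact sahiPositive_zero ν
  | k + 1 => exact (sahiPositive_iff_indicators ν (k + 1)).2 (sahiE_setInd_nonneg_of_two_of_coSingleton hν0 hν1 hS2 hco k)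

/-- **STRUCTURE THEOREM (`Sun m`, every `m`, every probability weight).**  Sahi positivity of every order ⟺ `SahiPositive ν 2` ∧ `E_k ≥ 0` for
every co-singleton `U`-family (`S_i ∌ x_i`, `S_j ∋ x_i` for `j ≠ i`, the `x_i` distinct; necessarily `3 ≤ k ≤ m`).  On `Sun m` the families of up-sets
without an absorbing member are exactly these (memo SAHI-ROUTE §4.12(a)); `k = m` with `T_i = ∅` is the top row `E_m(D_1, …, D_m)`. [this work] -/
theorem sahiPositive_iff_two_and_coSingleton {ν : Sun m → ℝ} (hν0 : ∀ x, 0 ≤ ν x) (hν1 : ∑ x, ν x = 1) :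
    (∀ n, SahiPositive ν n) ↔ SahiPositive ν 2 ∧
      ∀ (k : ℕ) (S : Fin (k + 3) → Finset (Fin m)) (x : Fin (k + 3) → Fin m), Function.Injective x →
        (∀ i, x i ∉ S i) → (∀ i j, i ≠ j → x i ∈ S j) → 0 ≤ sahiE ν (k + 3) (fun i => setInd (U (S i))) := by
  constructor
  · intro h
    exact ⟨h 2, fun k S _ _ _ _ => (sahiPositive_iff_indicators ν (k + 3)).1 (h (k + 3)) (fun i => U (S i)) fun i => isUpperSet_U _⟩
  · rintro ⟨hS2, hco⟩ n
    exact sahiPositive_of_two_of_coSingleton hν0 hν1 hS2 hco n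

/-! ## The pair layer from the petal-pair condition (the top row implies it) -/

/-- **Pairs from `c_A c_B ≤ ab`.**  If `(Σ_{j∈A} c_j)(Σ_{j∈B} c_j) ≤ a·b` for all disjoint petal index sets `A, B` (implied by `ab ≥ e₂(c)`, which
the top row `E_m(D) ≥ 0` implies in its closed form), then the weight is Sahi-positive of order `2`: a non-nested pair `(U_S, U_T)` has
`E₂ = δ(1 − δ − c_{S∖T} − c_{T∖S}) − c_{S∖T}c_{T∖S} ≥ δ·a − ab ≥ 0` with `δ = b + c_{S∩T} ≥ b`. [this work] -/
theorem sahiPositive_two_of_petalPairs {ν : Sun m → ℝ} (hν0 : ∀ x, 0 ≤ ν x) (hν1 : ∑ x, ν x = 1)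
    (hab : ∀ A B : Finset (Fin m), Disjoint A B → (∑ j ∈ A, ν (pet j)) * (∑ j ∈ B, ν (pet j)) ≤ ν core * ν out) :
    SahiPositive ν 2 := by
  rw [sahiPositive_iff_indicators]
  intro W hW
  rw [sahiE_two_apply, setInd_mul]
  have hle1 := ex_setInd_le_one hν0 hν1
  have hnn : ∀ V : Finset (Sun m), 0 ≤ ex ν (setInd V) := fun V => ex_nonneg hν0 fun x => setInd_nonneg _ _
  by_cases h01 : W 1 ⊆ W 0
  · rw [Finset.inter_eq_right.2 h01]
    nlinarith [hle1 (W 0), hnn (W 1), hnn (W 0)]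
  · by_cases h10 : W 0 ⊆ W 1
    · rw [Finset.inter_eq_left.2 h10]
      nlinarith [hle1 (W 1), hnn (W 0), hnn (W 1)]
    · -- both are `U`-sets
      have hanti : Pairwise fun i j => ¬ W j ⊆ W i := by
        intro i j hij
        fin_cases i <;> fin_cases j
        · exact absurd rfl hij
        · exact h01
        · exact h10
        · exact absurd rfl hij
      obtain ⟨S, hS⟩ := exists_eq_U_of_antichain W hW hanti
      rw [hS 0, hS 1, U_inter, ex_setInd_U, ex_setInd_U, ex_setInd_U]
      set cI := ∑ j ∈ S 0 ∩ S 1, ν (pet j) with hcI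
      set c1 := ∑ j ∈ S 0 \ S 1, ν (pet j) with hc1
      set c2 := ∑ j ∈ S 1 \ S 0, ν (pet j) with hc2
      have hp : ∀ j, 0 ≤ ν (pet j) := fun j => hν0 _
      have e0 : ∑ j ∈ S 0, ν (pet j) = cI + c1 := (Finset.sum_inter_add_sum_sdiff (S 0) (S 1) _).symm
      have e1 : ∑ j ∈ S 1, ν (pet j) = cI + c2 := by
        rw [hcI, Finset.inter_comm]; exact (Finset.sum_inter_add_sum_sdiff (S 1) (S 0) _).symm
      -- the three disjoint petal sets have total mass ≤ Σ_j c_j = 1 − a − b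
      have hU : ∑ j ∈ S 0 ∪ (S 1 \ S 0), ν (pet j) = (cI + c1) + c2 := by
        rw [Finset.sum_union Finset.disjoint_sdiff, e0]
      have hle : (cI + c1) + c2 ≤ ∑ j, ν (pet j) := by
        rw [← hU]; exact Finset.sum_le_sum_of_subset_of_nonneg (Finset.subset_univ _) fun j _ _ => hp j
      have htot : ν core + ν out + ∑ j, ν (pet j) = 1 := by rw [← sum_eq]; exact hν1
      have hcI0 : 0 ≤ cI := Finset.sum_nonneg fun j _ => hp j
      have hc10 : 0 ≤ c1 := Finset.sum_nonneg fun j _ => hp j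
      have hc20 : 0 ≤ c2 := Finset.sum_nonneg fun j _ => hp j
      have ha := hν0 core
      have hb := hν0 out
      have h12 : c1 * c2 ≤ ν core * ν out :=
        hab _ _ (Disjoint.mono_left Finset.sdiff_subset Finset.disjoint_sdiff)
      rw [e0, e1]
      have hδ : ν out * ν core ≤ (ν out + cI) * (1 - (ν out + cI) - c1 - c2) :=
        mul_le_mul (by linarith) (by linarith) ha (by linarith)
      nlinarith [hδ, h12]

end Sun
end Summit.CriticalPhenomena.PercolationContinuityZ3.Theorems.SahiDeltaSystem
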